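import Literature.NumberTheory.ComplexMultiplication.CMOrderGorenstein
import HarnessLib

/-!
# Bass orders in any degree: `R` is Bass ⟺ `ICM(R) = ⊔ Pic(S)` ⟺ `ICM(R)` is Clifford (Marseglia 2019,
# Prop. 3.7), and «`𝒪_K` is the only order whose ideals are all invertible»

Family `hodge`, lane `lit-hodgefound` (Track 2 foundations library; seat p15, row g25-#2 — sequel of g25-#1
`CMOrderGorenstein` (Buchmann–Lenstra Prop. 2.7: an over-order `M` is Gorenstein ⟺ `(I:I) = M` iff `I` invertible in
`M` ⟺ `Mᵗ` invertible in `M`) and the general-degree form of g24-#1 `CMOrderQuadraticBass` (every QUADRATIC order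
is Bass)), topic `Literature/NumberTheory/ComplexMultiplication`.  THEOREMS ONLY: no definition, no instance, no
named fact (D-0026, net Literature debt `0`).

Carriers, BY NAME, as in `CMOrderGorenstein`: `𝔬 = endOrder (M_μ)` (`μ : Basis ι ℚ K`, ANY degree; §1 for every
order `𝔯 = endOrder ρ`), Mathlib's `FractionalIdeal 𝔬⁰ K` with the ideal quotient `/`, over-orders as idempotents
`M = MM ≠ 0` (LEMMA 2.2, `CMOrderOverordersIdempotents`), `M`-ideals `MI = I`, the trace dual `↑TM = Mᵗ`
(`Submodule.traceDual ℤ ℚ`).  The three properties of PROP. 3.7 are written: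
(a) «`R` is Bass» = every over-order is Gorenstein in the reflexive form of PROP. 2.10 (a):
    `∀ M, M ≠ 0 → MM = M → ∀ I ≠ 0, MI = I → (M:(M:I)) = I`;
(b) «the inclusion `ICM(R) ⊇ ⊔ Pic(S)` is an equality» = every `I ≠ 0` is invertible in its own multiplicator ring,
    `I·((I:I):I) = (I:I)` (the shape of g24-#1's `mul_div_self_div_eq_div_self`);
(c) «`ICM(R)` is Clifford» (a disjoint union of groups) = every `I ≠ 0` is invertible in SOME over-order over which
    it is a module, `∃ M J, M ≠ 0 ∧ MM = M ∧ MI = I ∧ IJ = M`; §2 shows this is the class-level statement «`[I]`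
    lies in the group `Gₑ` of an idempotent `e = [N]` of `ICM(R) = 𝓘(R)/K^×`» (`NN = xN`, `NI = uI`, `IJ = vN`).

## Source, VERBATIM

S. Marseglia, *Computing the ideal class monoid of an order*, J. Lond. Math. Soc. (2) 101 (2020) [Marseglia2019],
held `paper:arxiv-1805.09671`, §3 p. 6 (chunk p0006) and §2 p. 5 (chunk p0005):

> It follows that `ICM(R) ⊇ ⊔ Pic(S)` (3.1) where the disjoint union is taken over the set of over-orders `S` of
> `R`. Recall that a commutative monoid is called Clifford if it is a disjoint union of groups.
> **Proposition 3.7.** The following are equivalent: (a) `R` is Bass, (b) the inclusion in (3.1) is an equality,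
> (c) `ICM(R)` is Clifford.
> *Proof.* (a)⇒(b): If `R` is Bass then every over-order is Gorenstein and in particular every fractional `R`-ideal
> `I` is invertible in its own multiplicator ring `S`. This means that `[I]` is in `Pic(S)` and (b) holds.
> (b)⇒(c): This is obvious. (c)⇒(a): Write `ICM(R) = ⊔ₑ Gₑ`, where `e` runs over the set of idempotent elements of
> `ICM(R)`, and `Gₑ` denotes the group with unit `e`. Let `J` be a fractional `R`-ideal representing `e`. Then
> there exists `x ∈ K^×` such that `xJ² = J`. Put `S = xJ`. Then `S² = x²J² = x(xJ²) = xJ = S`. Note that `S` is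
> another representative of the class `e` and by Lemma 2.2 it is an over-order of `R`. Now let `T` be any
> over-order of `R`. We want to show that `Tᵗ` is invertible in `T`. Say that the class representing `Tᵗ` lies in
> `Gₑ` where `e = [S]`. Then `Tᵗ` is invertible in `S` and, since the multiplicator ring of `Tᵗ` is `T`, by
> Lemma 2.5, we have that `S = T`.
> (§2, p. 5) An order `R` is called a Bass order if every over-order of `R` is Gorenstein […]. Observe that every
> order in a quadratic number field is a Bass order. […] Observe that `𝒪_K` is the only order in `K` whose ideals
> are all invertible.  (§3, p. 6) `Pic(R) ⊆ ICM(R)`. Observe that equality holds if and only if `R = 𝒪_K`.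

## What is formalised

* §1 (ANY order `𝔯 = endOrder ρ`, no trace duals): **(a)⇒(b)** `EndOrder.mul_div_self_div_eq_div_self_of_forall_div_div_eq`
  (if `S = (I:I)` is Gorenstein then `I·(S:I) = S` — `CMOrderGorenstein.mul_div_eq_of_forall_div_div_eq` at `M = (I:I)`),
  `EndOrder.forall_mul_div_self_div_eq_of_forall_overorder_div_div_eq`, and PROP. 2.10 (b) for `M` from (b):
  `EndOrder.div_self_eq_iff_mul_div_eq_of_mul_div_self_div_eq`.
* §2 (`𝔬 = endOrder (M_μ)`): **(b)⇒(a)** `div_div_eq_of_forall_mul_div_self_div_eq` (through PROP. 2.7 (b)⇒(c)⇒(a) of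
  `CMOrderGorenstein`), **(a)⟺(b)** `forall_overorder_div_div_eq_iff_forall_mul_div_self_div_eq`; **(b)⇒(c)**
  `exists_idempotent_invertible_of_mul_div_self_div_eq`, **(c)⇒(b)** `mul_div_self_div_eq_div_self_of_invertible`
  (LEMMA 2.5), **(b)⟺(c)** `forall_mul_div_self_div_eq_iff_forall_exists_idempotent_invertible`; the class-level reading
  **`exists_class_invertible_iff_exists_idempotent_invertible`** («`S = xJ` … `S² = S`»); **(c)⇒(a) AS PRINTED**
  `exists_traceDual_mul_eq_of_exists_idempotent_invertible` («`Tᵗ` is invertible in `S` … `S = T`»),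
  `div_div_eq_of_forall_exists_idempotent_invertible`, and **(a)⟺(c)**
  `forall_overorder_div_div_eq_iff_forall_exists_idempotent_invertible`.
* §3 **«`𝒪_K` is the only order in `K` whose ideals are all invertible» / «`Pic(R) = ICM(R)` iff `R = 𝒪_K`»**:
  `eq_one_of_forall_isUnit` (no proper over-order), **`forall_isUnit_iff_endOrder_eq_range`** (⟸ by Mathlib's
  Dedekind-domain theory through the tree's `isIntegrallyClosed_endOrder_iff_eq_range`),
  `mul_div_self_div_eq_div_self_of_endOrder_eq_range` (the maximal order is Bass).
* §4 VALIDATION at `g = 1` (`μ : Basis (Fin 2) ℚ K`): **`div_div_eq_of_finrank_eq_two`** — every over-order `M` of a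
  quadratic order is Gorenstein, `(M:(M:I)) = I` (new for `M ≠ 𝔬`; `M = 𝔬` is g24-#3's `one_div_one_div_eq`), and
  `traceDual_mul_div_eq_of_finrank_eq_two` (`Mᵗ·(M:Mᵗ) = M`).

NOT formalised: the monoid structure on the quotient TYPE `ICM(R)` (the tree's `ICM` is the `Quot` of
`CMTorusIsomorphismClassesOrderFinite` §5, with no multiplication) — (c) is stated on representatives; the other
characterisations of Bass orders («`𝒪_K/R` cyclic», Levy–Wiegand) and Remark 3.8.

## References
* [Marseglia2019] S. Marseglia, *Computing the ideal class monoid of an order*, J. Lond. Math. Soc. (2) 101 (2020)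
  984–1007, §3 (3.1), Prop. 3.7, p. 6; §2 Lemma 2.5, Prop. 2.10, p. 5. [cite: Marseglia2019, §3 Prop. 3.7, p. 6]
* [BuchmannLenstra1994] J. A. Buchmann, H. W. Lenstra, Jr., *Approximating rings of integers in number fields*,
  J. Théor. Nombres Bordeaux 6 (1994) 221–260, §2 Prop. 2.7, p. 230. [cite: BuchmannLenstra1994, §2 Prop. 2.7, p. 230]
-/

noncomputable section

open scoped nonZeroDivisors NumberField Pointwise
open NumberField Module FractionalIdeal
open Submodule (traceDual)

namespace Literature.NumberTheory.ComplexMultiplication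

namespace EndOrder

/-! ## §1 PROPOSITION 3.7 (a)⟺(b), for every order `𝔯 = endOrder ρ` (no trace duals): every over-order is
Gorenstein (reflexive) iff every fractional ideal is invertible in its own multiplicator ring -/

section BassAB

variable {K : Type} [Field K] [NumberField K]
variable {ι : Type} [Fintype ι] [DecidableEq ι] [Nonempty ι] {ρ : K →ₐ[ℚ] Matrix ι ι ℚ}
variable [IsFractionRing (endOrder ρ) K]

/-- **PROPOSITION 3.7, (a)⇒(b): «If `R` is Bass then every over-order is Gorenstein and in particular every
fractional `R`-ideal `I` is invertible in its own multiplicator ring `S`»** — with the explicit inverse `(S : I)`: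
if the over-order `S = (I:I)` is Gorenstein (`(S:(S:N)) = N` for all `S`-ideals `N`) then `I·((I:I):I) = (I:I)`.
[cite: Marseglia2019, §3 Prop. 3.7 ((a)⇒(b)), p. 6] [cite: BuchmannLenstra1994, §2 Prop. 2.7 ((a)⇒(b)), p. 230] -/
theorem mul_div_self_div_eq_div_self_of_forall_div_div_eq {I : FractionalIdeal (endOrder ρ)⁰ K} (hI : I ≠ 0)
    (ha : ∀ N : FractionalIdeal (endOrder ρ)⁰ K, N ≠ 0 → I / I * N = N → I / I / (I / I / N) = N) :
    I * (I / I / I) = I / I :=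
  mul_div_eq_of_forall_div_div_eq (div_self_mul_div_self hI) (div_self_ne_zero hI) ha hI (div_self_mul_self_eq hI) rfl

/-- **PROPOSITION 3.7, (a)⇒(b) for the whole order: `R` Bass (every over-order `M = MM ≠ 0` reflexive) ⟹ every
nonzero fractional ideal is invertible in its multiplicator ring** («This means that `[I]` is in `Pic(S)` and (b)
holds»: `ICM(R) = ⊔ Pic(S)`). [cite: Marseglia2019, §3 Prop. 3.7 ((a)⇒(b)), p. 6] -/
theorem forall_mul_div_self_div_eq_of_forall_overorder_div_div_eq
    (ha : ∀ M : FractionalIdeal (endOrder ρ)⁰ K, M ≠ 0 → M * M = M →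
      ∀ N : FractionalIdeal (endOrder ρ)⁰ K, N ≠ 0 → M * N = N → M / (M / N) = N)
    {I : FractionalIdeal (endOrder ρ)⁰ K} (hI : I ≠ 0) : I * (I / I / I) = I / I :=
  mul_div_self_div_eq_div_self_of_forall_div_div_eq hI (ha _ (div_self_ne_zero hI) (div_self_mul_div_self hI))

/-- **(b) rephrased: if `I` is invertible in its multiplicator ring then `(I:I) = M ⟺ I` is invertible in `M`** for
every over-order `M` over which `I` is a module — property (b) of PROP. 2.10 for `M` («for every fractional `R`-ideal
`I`, we have `(I:I) = R` if and only if `I` is invertible», ⟸ being LEMMA 2.5).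
[cite: Marseglia2019, §2 Prop. 2.10 (b) and Lemma 2.5, p. 5] -/
theorem div_self_eq_iff_mul_div_eq_of_mul_div_self_div_eq {M I : FractionalIdeal (endOrder ρ)⁰ K} (hMM : M * M = M)
    (hM0 : M ≠ 0) (hMI : M * I = I) (hb : I * (I / I / I) = I / I) : I / I = M ↔ I * (M / I) = M := by
  refine ⟨fun h => by rw [← h, hb], fun h => div_self_eq_of_mul_eq_overorder hMM hM0 hMI h⟩

end BassAB

end EndOrder

namespace CMTypeLattice

section Bass

variable {K : Type} [Field K] [NumberField K]
variable {ι : Type} [Fintype ι] [DecidableEq ι] [Nonempty ι] (μ : Basis ι ℚ K)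
variable [IsFractionRing (endOrder (Algebra.leftMulMatrix μ)) K]

/-- **PROPOSITION 3.7, (b)⇒(a): if every nonzero fractional ideal of `𝔬` is invertible in its own multiplicator
ring, then every over-order `M` of `𝔬` is Gorenstein** (`(M:(M:I)) = I` for all `M`-ideals `I`): property (b) of
PROP. 2.10 holds for `M`, hence (a) by `CMOrderGorenstein` §6 (through `Mᵗ`). [cite: Marseglia2019, §3 Prop. 3.7
((b)⇒(c)⇒(a)) with §2 Prop. 2.10, pp. 5–6] -/
theorem div_div_eq_of_forall_mul_div_self_div_eq
    (hb : ∀ I : FractionalIdeal (endOrder (Algebra.leftMulMatrix μ))⁰ K, I ≠ 0 → I * (I / I / I) = I / I)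
    {M : FractionalIdeal (endOrder (Algebra.leftMulMatrix μ))⁰ K} (hMM : M * M = M) (hM0 : M ≠ 0)
    {I : FractionalIdeal (endOrder (Algebra.leftMulMatrix μ))⁰ K} (hI : I ≠ 0) (hMI : M * I = I) : M / (M / I) = I :=
  (forall_div_div_eq_iff_forall_div_self_eq_iff_mul_div_eq μ hMM hM0).2
    (fun _ hI' hMI' => EndOrder.div_self_eq_iff_mul_div_eq_of_mul_div_self_div_eq hMM hM0 hMI' (hb _ hI')) I hI hMI

/-- **PROPOSITION 3.7, (a)⟺(b): `R` is Bass — every over-order `M = MM ≠ 0` of `R = 𝔬` is Gorenstein — iff the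
inclusion `ICM(R) ⊇ ⊔ Pic(S)` is an equality, i.e. every nonzero fractional ideal is invertible in its own
multiplicator ring, `I·((I:I):I) = (I:I)`.** [cite: Marseglia2019, §3 Prop. 3.7 ((a)⟺(b)), p. 6] -/
theorem forall_overorder_div_div_eq_iff_forall_mul_div_self_div_eq :
    (∀ M : FractionalIdeal (endOrder (Algebra.leftMulMatrix μ))⁰ K, M ≠ 0 → M * M = M →
      ∀ I : FractionalIdeal (endOrder (Algebra.leftMulMatrix μ))⁰ K, I ≠ 0 → M * I = I → M / (M / I) = I) ↔
    ∀ I : FractionalIdeal (endOrder (Algebra.leftMulMatrix μ))⁰ K, I ≠ 0 → I * (I / I / I) = I / I :=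
  ⟨fun ha _ hI => EndOrder.forall_mul_div_self_div_eq_of_forall_overorder_div_div_eq ha hI,
    fun hb _ hM0 hMM _ hI hMI => div_div_eq_of_forall_mul_div_self_div_eq μ hb hMM hM0 hI hMI⟩

/-! ## §2 PROPOSITION 3.7 (b)⟺(c): `ICM(R) = ⊔ Pic(S)` iff `ICM(R)` is Clifford (every class lies in a group) -/

omit [Nonempty ι] in
/-- **(b)⇒(c) «This is obvious»**: if `I` is invertible in its multiplicator ring then its class lies in the group
`Pic(S)`, `S = (I:I)` — there are an idempotent `M = MM ≠ 0` with `MI = I` and a `J` with `IJ = M`.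
[cite: Marseglia2019, §3 Prop. 3.7 ((b)⇒(c)), p. 6] -/
theorem exists_idempotent_invertible_of_mul_div_self_div_eq {I : FractionalIdeal (endOrder (Algebra.leftMulMatrix μ))⁰ K}
    (hI : I ≠ 0) (hb : I * (I / I / I) = I / I) :
    ∃ M J : FractionalIdeal (endOrder (Algebra.leftMulMatrix μ))⁰ K, M ≠ 0 ∧ M * M = M ∧ M * I = I ∧ I * J = M :=
  ⟨I / I, I / I / I, EndOrder.div_self_ne_zero hI, EndOrder.div_self_mul_div_self hI, EndOrder.div_self_mul_self_eq hI, hb⟩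

/-- **(c)⇒(b) at the level of ideals**: if `I` is invertible in SOME over-order `M` over which it is a module
(`MI = I`, `IJ = M`), then `M = (I:I)` (LEMMA 2.5) and `I·((I:I):I) = (I:I)`. [cite: Marseglia2019, §3 Prop. 3.7 and
§2 Lemma 2.5 («Then `R` is the multiplicator ring of `I`»), pp. 5–6] -/
theorem mul_div_self_div_eq_div_self_of_invertible {M I J : FractionalIdeal (endOrder (Algebra.leftMulMatrix μ))⁰ K}
    (hMM : M * M = M) (hM0 : M ≠ 0) (hMI : M * I = I) (hIJ : I * J = M) : I * (I / I / I) = I / I := by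
  have hI : I ≠ 0 := fun h => hM0 (by rw [← hIJ, h, zero_mul])
  have hS : I / I = M := EndOrder.div_self_eq_of_mul_eq_overorder hMM hM0 hMI hIJ
  rw [hS]
  refine le_antisymm (EndOrder.mul_div_le hI) ?_
  calc M = I * J := hIJ.symm
    _ ≤ I * (M / I) := mul_le_mul' le_rfl ((le_div_iff_mul_le hI).2 (by rw [mul_comm, hIJ]))

/-- **PROPOSITION 3.7, (b)⟺(c) on ideals: every `I ≠ 0` is invertible in its own multiplicator ring iff every
`I ≠ 0` is invertible in SOME over-order over which it is a module** («`ICM(R)` is Clifford», i.e. a disjoint union of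
groups: every class lies in some `Pic(S)`). [cite: Marseglia2019, §3 Prop. 3.7 ((b)⟺(c)), p. 6] -/
theorem forall_mul_div_self_div_eq_iff_forall_exists_idempotent_invertible :
    (∀ I : FractionalIdeal (endOrder (Algebra.leftMulMatrix μ))⁰ K, I ≠ 0 → I * (I / I / I) = I / I) ↔
    ∀ I : FractionalIdeal (endOrder (Algebra.leftMulMatrix μ))⁰ K, I ≠ 0 →
      ∃ M J : FractionalIdeal (endOrder (Algebra.leftMulMatrix μ))⁰ K, M ≠ 0 ∧ M * M = M ∧ M * I = I ∧ I * J = M :=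
  ⟨fun hb I hI => exists_idempotent_invertible_of_mul_div_self_div_eq μ hI (hb I hI),
    fun hc I hI => by
      obtain ⟨M, J, hM0, hMM, hMI, hIJ⟩ := hc I hI
      exact mul_div_self_div_eq_div_self_of_invertible μ hMM hM0 hMI hIJ⟩

/-- **«`ICM(R)` is Clifford» read on CLASSES**: the class `[I]` lies in the group `G_e` of an idempotent `e = [N]`
(`NN = xN`, `x ∈ K^×`) of `ICM(R) = 𝓘(R)/K^×` — `[N][I] = [I]` and `[I][J] = [N]` for some `[J]`, i.e. `NI = uI`,
`IJ = vN` with `u, v ∈ K^×` — iff `I` is invertible in some over-order `M = MM` over which it is a module (rescale: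
`S = x⁻¹N` is an over-order, LEMMA 2.2 / `exists_mul_self_eq_spanSingleton_mul_iff`; `SI = u′I ≃ I` forces `SI = I`
by LEMMA 3.6). [cite: Marseglia2019, §3 Prop. 3.7 ((c): «Write `ICM(R) = ⊔ₑ Gₑ` … `xJ² = J`. Put `S = xJ`»), p. 6] -/
theorem exists_class_invertible_iff_exists_idempotent_invertible {I : FractionalIdeal (endOrder (Algebra.leftMulMatrix μ))⁰ K}
    (hI : I ≠ 0) :
    (∃ N J : FractionalIdeal (endOrder (Algebra.leftMulMatrix μ))⁰ K, ∃ x u v : K, x ≠ 0 ∧ u ≠ 0 ∧ v ≠ 0 ∧ N ≠ 0 ∧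
        N * N = spanSingleton (endOrder (Algebra.leftMulMatrix μ))⁰ x * N ∧
        N * I = spanSingleton (endOrder (Algebra.leftMulMatrix μ))⁰ u * I ∧
        I * J = spanSingleton (endOrder (Algebra.leftMulMatrix μ))⁰ v * N) ↔
    ∃ M J : FractionalIdeal (endOrder (Algebra.leftMulMatrix μ))⁰ K, M ≠ 0 ∧ M * M = M ∧ M * I = I ∧ I * J = M := by
  haveI := isNoetherianRing_endOrder (Algebra.leftMulMatrix μ)
  constructor
  · rintro ⟨N, J, x, u, v, hx, hu, hv, hN0, hNN, hNI, hIJ⟩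
    -- `M = x⁻¹N` is an over-order
    set M : FractionalIdeal (endOrder (Algebra.leftMulMatrix μ))⁰ K :=
      spanSingleton (endOrder (Algebra.leftMulMatrix μ))⁰ x⁻¹ * N with hM
    have hNM : spanSingleton (endOrder (Algebra.leftMulMatrix μ))⁰ x * M = N := by
      rw [hM, ← mul_assoc, spanSingleton_mul_spanSingleton, mul_inv_cancel₀ hx, spanSingleton_one, one_mul]
    have hM0 : M ≠ 0 := fun h0 => hN0 (by rw [← hNM, h0, mul_zero])
    have hMM : M * M = M := by
      rw [hM, mul_mul_mul_comm, spanSingleton_mul_spanSingleton, hNN, ← mul_assoc, spanSingleton_mul_spanSingleton,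
        show x⁻¹ * x⁻¹ * x = x⁻¹ by rw [mul_assoc, inv_mul_cancel₀ hx, mul_one]]
    -- `MI = (u/x)I`, and `MI ⊇ I ∋` forces `MI = I`: `M ⊆ (MI : MI) = (I : I)`
    have hMI' : M * I = spanSingleton (endOrder (Algebra.leftMulMatrix μ))⁰ (x⁻¹ * u) * I := by
      rw [hM, mul_assoc, hNI, ← mul_assoc, spanSingleton_mul_spanSingleton]
    have hxu : x⁻¹ * u ≠ 0 := mul_ne_zero (inv_ne_zero hx) hu
    have h1M : (1 : K) ∈ M := EndOrder.one_mem_of_mul_self_eq hM0 hMM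
    have hMI : M * I = I := by
      refine le_antisymm ?_ fun y hy => by rw [← one_mul y]; exact mul_mem_mul h1M hy
      -- `M ⊆ (MI : MI) = ((u/x)I : (u/x)I) = (I : I)`
      have hle : M ≤ I / I := by
        rw [← EndOrder.spanSingleton_mul_div_spanSingleton_mul hxu hI, ← hMI', le_div_iff_mul_le
          (EndOrder.fractionalIdeal_mul_ne_zero hM0 hI), ← mul_assoc, hMM]
      calc M * I ≤ I / I * I := mul_le_mul' hle le_rfl
        _ = I := EndOrder.div_self_mul_self_eq hI
    -- `IJ = vN = vx·M`, so `I·((vx)⁻¹J) = M`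
    refine ⟨M, spanSingleton (endOrder (Algebra.leftMulMatrix μ))⁰ (v * x)⁻¹ * J, hM0, hMM, hMI, ?_⟩
    rw [mul_left_comm, hIJ, ← hNM, ← mul_assoc, ← mul_assoc, spanSingleton_mul_spanSingleton,
      spanSingleton_mul_spanSingleton, show (v * x)⁻¹ * v * x = 1 by field_simp, spanSingleton_one, one_mul]
  · rintro ⟨M, J, hM0, hMM, hMI, hIJ⟩
    exact ⟨M, J, 1, 1, 1, one_ne_zero, one_ne_zero, one_ne_zero, hM0, by rw [spanSingleton_one, one_mul, hMM],
      by rw [spanSingleton_one, one_mul, hMI], by rw [spanSingleton_one, one_mul, hIJ]⟩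

/-- **PROPOSITION 3.7, (c)⇒(a), the printed route through `Tᵗ`: «let `T` be any over-order of `R`. We want to show
that `Tᵗ` is invertible in `T`. Say that the class representing `Tᵗ` lies in `Gₑ` where `e = [S]`. Then `Tᵗ` is
invertible in `S` and, since the multiplicator ring of `Tᵗ` is `T`, by Lemma 2.5, we have that `S = T`.»** — here
with `T ↦ M`, `Tᵗ ↦ TM`. [cite: Marseglia2019, §3 Prop. 3.7 ((c)⇒(a)), p. 6] -/
theorem exists_traceDual_mul_eq_of_exists_idempotent_invertible {M TM : FractionalIdeal (endOrder (Algebra.leftMulMatrix μ))⁰ K}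
    (hMM : M * M = M) (hM0 : M ≠ 0) (hTM0 : TM ≠ 0)
    (hTM : (TM : Submodule (endOrder (Algebra.leftMulMatrix μ)) K) =
      traceDual ℤ ℚ (M : Submodule (endOrder (Algebra.leftMulMatrix μ)) K))
    (hc : ∃ S J : FractionalIdeal (endOrder (Algebra.leftMulMatrix μ))⁰ K, S ≠ 0 ∧ S * S = S ∧ S * TM = TM ∧ TM * J = S) :
    ∃ J : FractionalIdeal (endOrder (Algebra.leftMulMatrix μ))⁰ K, TM * J = M := by
  obtain ⟨S, J, hS0, hSS, hSTM, hTMJ⟩ := hc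
  -- `S = (Tᵗ : Tᵗ) = T`
  have hSM : S = M := by
    rw [← EndOrder.div_self_eq_of_mul_eq_overorder hSS hS0 hSTM hTMJ, traceDual_div_traceDual_eq_of_mul_self_eq μ hMM hM0 hTM0 hTM]
  exact ⟨J, by rw [hTMJ, hSM]⟩

/-- **PROPOSITION 3.7, (c)⇒(a): if `ICM(R)` is Clifford — every nonzero fractional ideal is invertible in some
over-order over which it is a module — then `R` is Bass: every over-order `M` is Gorenstein** (`Mᵗ` is invertible in
`M`, then `CMOrderGorenstein.div_div_eq_of_traceDual_mul_eq`). [cite: Marseglia2019, §3 Prop. 3.7 ((c)⇒(a)), p. 6] -/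
theorem div_div_eq_of_forall_exists_idempotent_invertible
    (hc : ∀ I : FractionalIdeal (endOrder (Algebra.leftMulMatrix μ))⁰ K, I ≠ 0 →
      ∃ S J : FractionalIdeal (endOrder (Algebra.leftMulMatrix μ))⁰ K, S ≠ 0 ∧ S * S = S ∧ S * I = I ∧ I * J = S)
    {M : FractionalIdeal (endOrder (Algebra.leftMulMatrix μ))⁰ K} (hMM : M * M = M) (hM0 : M ≠ 0)
    {I : FractionalIdeal (endOrder (Algebra.leftMulMatrix μ))⁰ K} (hI : I ≠ 0) (hMI : M * I = I) : M / (M / I) = I := by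
  obtain ⟨TM, hTM0, hTM⟩ := exists_coe_eq_traceDual μ hM0
  obtain ⟨J, hJ⟩ := exists_traceDual_mul_eq_of_exists_idempotent_invertible μ hMM hM0 hTM0 hTM (hc TM hTM0)
  exact div_div_eq_of_traceDual_mul_eq μ hMM hM0 hTM hJ hI hMI

/-- **PROPOSITION 3.7: (a) `R` is Bass ⟺ (c) `ICM(R)` is Clifford** (every class lies in some `Pic(S)`).
[cite: Marseglia2019, §3 Prop. 3.7 ((a)⟺(c)), p. 6] -/
theorem forall_overorder_div_div_eq_iff_forall_exists_idempotent_invertible :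
    (∀ M : FractionalIdeal (endOrder (Algebra.leftMulMatrix μ))⁰ K, M ≠ 0 → M * M = M →
      ∀ I : FractionalIdeal (endOrder (Algebra.leftMulMatrix μ))⁰ K, I ≠ 0 → M * I = I → M / (M / I) = I) ↔
    ∀ I : FractionalIdeal (endOrder (Algebra.leftMulMatrix μ))⁰ K, I ≠ 0 →
      ∃ M J : FractionalIdeal (endOrder (Algebra.leftMulMatrix μ))⁰ K, M ≠ 0 ∧ M * M = M ∧ M * I = I ∧ I * J = M := by
  rw [forall_overorder_div_div_eq_iff_forall_mul_div_self_div_eq μ,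
    forall_mul_div_self_div_eq_iff_forall_exists_idempotent_invertible μ]

/-! ## §3 «`𝒪_K` is the only order in `K` whose ideals are all invertible»; «`Pic(R) ⊆ ICM(R)` … equality holds if
and only if `R = 𝒪_K`» -/

/-- **An order all of whose nonzero fractional ideals are invertible has no over-order but itself**: every
idempotent `M = MM ≠ 0` equals `1` (it is invertible with `(M:M) = M`, and invertible ideals have `(M:M) = 𝔬`).
[cite: Marseglia2019, §2 («Observe that `𝒪_K` is the only order in `K` whose ideals are all invertible»), p. 5] -/
theorem eq_one_of_forall_isUnit (h : ∀ I : FractionalIdeal (endOrder (Algebra.leftMulMatrix μ))⁰ K, I ≠ 0 → IsUnit I)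
    {M : FractionalIdeal (endOrder (Algebra.leftMulMatrix μ))⁰ K} (hMM : M * M = M) (hM0 : M ≠ 0) : M = 1 := by
  rw [← EndOrder.div_self_eq_of_mul_self_eq_endOrder hM0 hMM]
  exact EndOrder.fractionalIdeal_div_self_of_isUnit (h M hM0)

/-- **«`𝒪_K` is the only order in `K` whose ideals are all invertible»; «`Pic(R) ⊆ ICM(R)`. Observe that equality
holds if and only if `R = 𝒪_K`»**: every nonzero fractional ideal of `𝔬` is invertible iff `𝔬 = 𝓞_K` (⟹: the
over-order `𝓞_K` of `𝔬` is then `𝔬` itself; ⟸: `𝓞_K` is a Dedekind domain — the tree's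
`isIntegrallyClosed_endOrder_iff_eq_range` and Mathlib's `isDedekindDomain_iff`).
[cite: Marseglia2019, §2 p. 5 and §3 (after Def. 3.5), p. 6] -/
theorem forall_isUnit_iff_endOrder_eq_range :
    (∀ I : FractionalIdeal (endOrder (Algebra.leftMulMatrix μ))⁰ K, I ≠ 0 → IsUnit I) ↔
      endOrder (Algebra.leftMulMatrix μ) = (algebraMap (𝓞 K) K).range := by
  constructor
  · intro h
    obtain ⟨M, hM0, hMM, hMcoe⟩ := EndOrder.exists_fractionalIdeal_coe_eq_subring
      (endOrder_le_range (Algebra.leftMulMatrix μ)) (EndOrder.moduleFinite_of_le_range (K := K) le_rfl)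
    rw [eq_one_of_forall_isUnit μ h hMM hM0] at hMcoe
    ext x
    have hx : x ∈ ((1 : FractionalIdeal (endOrder (Algebra.leftMulMatrix μ))⁰ K) : Set K) ↔
        x ∈ ((algebraMap (𝓞 K) K).range : Set K) := by rw [hMcoe]
    rw [SetLike.mem_coe, SetLike.mem_coe, mem_one_iff] at hx
    rw [← hx]
    constructor
    · intro hx'
      exact ⟨⟨x, hx'⟩, rfl⟩
    · rintro ⟨y, rfl⟩
      exact y.2
  · intro h I hI
    haveI := isNoetherianRing_endOrder (Algebra.leftMulMatrix μ)
    haveI := dimensionLEOne_endOrder (Algebra.leftMulMatrix μ)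
    have hic : IsIntegrallyClosed (endOrder (Algebra.leftMulMatrix μ)) :=
      (isIntegrallyClosed_endOrder_iff_eq_range (Algebra.leftMulMatrix μ)).2 h
    haveI : IsDedekindDomain (endOrder (Algebra.leftMulMatrix μ)) :=
      (isDedekindDomain_iff _ K).mpr ⟨inferInstance, inferInstance, inferInstance, (isIntegrallyClosed_iff K).mp hic⟩
    exact (mul_inv_cancel_iff_isUnit K).1 (mul_inv_cancel₀ hI)

/-- **The maximal order is Bass (indeed has `ICM = Pic`)**: if `𝔬 = 𝓞_K` then every nonzero fractional ideal is
invertible in its multiplicator ring (which is `𝔬`). [cite: Marseglia2019, §3 («`Pic(R) ⊆ ICM(R)` … equality holds if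
and only if `R = 𝒪_K`») and Prop. 3.7, p. 6] -/
theorem mul_div_self_div_eq_div_self_of_endOrder_eq_range
    (h : endOrder (Algebra.leftMulMatrix μ) = (algebraMap (𝓞 K) K).range)
    {I : FractionalIdeal (endOrder (Algebra.leftMulMatrix μ))⁰ K} (hI : I ≠ 0) : I * (I / I / I) = I / I := by
  have hu : IsUnit I := (forall_isUnit_iff_endOrder_eq_range μ).2 h I hI
  have h1 : I / I = 1 := EndOrder.fractionalIdeal_div_self_of_isUnit hu
  rw [h1, ← inv_eq, (mul_inv_cancel_iff_isUnit K).2 hu]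

end Bass

/-! ## §4 Validation: every over-order of a QUADRATIC order is Gorenstein; `ICM(ℤ[√-3])` is Clifford -/

section Quadratic

variable {K : Type} [Field K] [NumberField K]
variable (μ : Basis (Fin 2) ℚ K) [IsFractionRing (endOrder (Algebra.leftMulMatrix μ)) K]

/-- **«every order in a quadratic number field is a Bass order» in form (a): every over-order `M` of a quadratic
order is Gorenstein, `(M:(M:I)) = I` for every `M`-ideal `I ≠ 0`** (from g24-#1's form (b)
`CMOrderQuadraticBass.mul_div_self_div_eq_div_self` by PROP. 3.7 (b)⇒(a); the case `M = 𝔬` is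
`CMOrderQuadraticOverorders.one_div_one_div_eq`). [cite: Marseglia2019, §2 («every order in a quadratic number field
is a Bass order») and §3 Prop. 3.7, pp. 5–6] -/
theorem div_div_eq_of_finrank_eq_two {M : FractionalIdeal (endOrder (Algebra.leftMulMatrix μ))⁰ K} (hMM : M * M = M)
    (hM0 : M ≠ 0) {I : FractionalIdeal (endOrder (Algebra.leftMulMatrix μ))⁰ K} (hI : I ≠ 0) (hMI : M * I = I) :
    M / (M / I) = I :=
  div_div_eq_of_forall_mul_div_self_div_eq μ (fun _ hI' => mul_div_self_div_eq_div_self μ hI') hMM hM0 hI hMI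

/-- **The trace dual of every over-order of a quadratic order is invertible in it: `Mᵗ·(M:Mᵗ) = M`** (PROP. 2.10 (c)
for each over-order — all over-orders of a quadratic order are Gorenstein). [cite: Marseglia2019, §2 Prop. 2.10 (c) and
«every order in a quadratic number field is a Bass order», p. 5] -/
theorem traceDual_mul_div_eq_of_finrank_eq_two {M TM : FractionalIdeal (endOrder (Algebra.leftMulMatrix μ))⁰ K}
    (hMM : M * M = M) (hM0 : M ≠ 0) (hTM0 : TM ≠ 0)
    (hTM : (TM : Submodule (endOrder (Algebra.leftMulMatrix μ)) K) =
      traceDual ℤ ℚ (M : Submodule (endOrder (Algebra.leftMulMatrix μ)) K)) : TM * (M / TM) = M :=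
  (forall_div_div_eq_iff_traceDual_mul_div_eq μ hMM hM0 hTM0 hTM).1 (fun _ hI hMI => div_div_eq_of_finrank_eq_two μ hMM hM0 hI hMI)

end Quadratic

end CMTypeLattice

end Literature.NumberTheory.ComplexMultiplication
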